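import Mathlib.RingTheory.Valuation.ValuationSubring
import Mathlib.RingTheory.LocalRing.MaximalIdeal.Basic
import Mathlib.Algebra.BigOperators.Group.Finset.Basic
import Summits.ResolutionOfSingularities.ResolutionOfSingularities.Theorems.ValuativeLuAlphaPTorsorAdaptedDefs
import HarnessLib

/-!
# The top coarsening of a flag-adapted chart (stub `stub_topCoarsening`, F4a)

Crux `Valuative.LuAlphaPTorsor` (stmt-ResolutionOfSingularities-0641), line
`pfaff-line-log-final-forms` (skeleton v6.3), stub `stub_topCoarsening` — the registered open
sub-goal F4a of the attack on the rank `≥ 2` Abhyankar core: for a FLAG-ADAPTED chart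
`(R, x, lv)` along `O` (`FlagAdaptedChart`, module `…ValuativeLuAlphaPTorsorAdaptedDefs`) whose
values are torsion over the lattice of parameter values, and `top` the highest level present,
the COARSENING

  `W := { z : v(z) ≤ v(x^m) for some m : Fin n → ℤ supported on the levels < top }`

is a valuation subring `⊇ O` with exactly this membership characterization; `W` has RANK ONE
in the elementary sense (`W.valuation z < 1`, `w ≠ 0` ⇒ some power of `z` is `W`-below `w`);
the parameters of level `< top` are `W`-units; and `(R, x_top)` is a very good `W`-chart (the
level-`top` parameters generate `𝔪_W ∩ R`, their `W`-values are `ℤ`-independent).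

Proof idea. `W` is constructed directly; its non-units are the `z` with `v(z) < v(x^m)` for ALL
low `m` (`topCoars_small_iff`). The centre is clause (C3) of `AdaptedChart` at `ℓ = top`;
independence is (C4) at `ℓ = top` (a `W`-unit top monomial is squeezed between low monomials);
rank one: by torsion `v(z)^{N₁} = v(x^a)`, `v(w)^{N₂} = v(x^b)`, the top part `a_T` of `a` is
smaller than all low monomials, the clause `LevelArchimedean` at `ℓ = top` gives `M` with
`v(x^{a_T})^M < v(x^{b_T})`, one spare factor `v(x^{a_T})` absorbs any low monomial
(`topCoars_uniform_arch`), and `N := N₁ (M + 1)` works (`N := 1` if `z = 0`). [folklore]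
-/

set_option linter.dupNamespace false

open IsLocalRing

namespace Summit.ResolutionOfSingularities.ResolutionOfSingularities.Theorems.PfaffLine

section LaurentMonomials

variable {Γ₀ : Type} [LinearOrderedCommGroupWithZero Γ₀] {n : ℕ}

/-- `τ^(m + m') = τ^m · τ^m'` for Laurent monomials in non-zero values. [folklore] -/
theorem topCoars_zprod_add (τ : Fin n → Γ₀) (hτ : ∀ j, τ j ≠ 0) (m m' : Fin n → ℤ) :
    (∏ j, τ j ^ ((m + m') j)) = (∏ j, τ j ^ (m j)) * ∏ j, τ j ^ (m' j) := by
  rw [← Finset.prod_mul_distrib]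
  exact Finset.prod_congr rfl fun j _ => by rw [Pi.add_apply, zpow_add₀ (hτ j)]

/-- `τ^(-m) = (τ^m)⁻¹`. [folklore] -/
theorem topCoars_zprod_neg (τ : Fin n → Γ₀) (m : Fin n → ℤ) :
    (∏ j, τ j ^ ((-m) j)) = (∏ j, τ j ^ (m j))⁻¹ := by
  rw [← Finset.prod_inv_distrib]
  exact Finset.prod_congr rfl fun j _ => by rw [Pi.neg_apply, zpow_neg]

/-- `τ^(N • m) = (τ^m)^N`. [folklore] -/
theorem topCoars_zprod_nsmul (τ : Fin n → Γ₀) (N : ℕ) (m : Fin n → ℤ) :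
    (∏ j, τ j ^ ((N • m) j)) = (∏ j, τ j ^ (m j)) ^ N := by
  rw [← Finset.prod_pow]
  exact Finset.prod_congr rfl fun j _ => by
    rw [Pi.smul_apply, nsmul_eq_mul, mul_comm, zpow_mul, zpow_natCast]

/-- A Laurent monomial in non-zero values is positive. [folklore] -/
theorem topCoars_zprod_pos (τ : Fin n → Γ₀) (hτ : ∀ j, τ j ≠ 0) (m : Fin n → ℤ) :
    0 < ∏ j, τ j ^ (m j) :=
  zero_lt_iff.mpr (Finset.prod_ne_zero_iff.mpr fun j _ => zpow_ne_zero _ (hτ j))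

/-- Re-indexing a Laurent monomial in the level-`top` parameters (enumerated by `e`) as a Laurent
monomial in all parameters (exponent `0` off level `top`). [folklore] -/
theorem topCoars_prod_reindex {M : Type} [CommGroupWithZero M] (lv : Fin n → ℕ) (top : ℕ)
    {nT : ℕ} (e : Fin nT ≃ {i : Fin n // lv i = top}) (f : Fin n → M) (m : Fin nT → ℤ)
    (μ : Fin n → ℤ) (hμ : ∀ i, μ i = if h : lv i = top then m (e.symm ⟨i, h⟩) else 0) :
    (∏ j, f (e j).1 ^ (m j)) = ∏ i, f i ^ (μ i) := by
  rw [← Fintype.prod_subtype_mul_prod_subtype (fun i => lv i = top) (fun i => f i ^ (μ i))]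
  rw [Fintype.prod_eq_one (fun i : {i : Fin n // ¬lv i = top} => f i.1 ^ (μ i.1))
      (fun i => by rw [hμ, dif_neg i.2, zpow_zero]), mul_one]
  exact Fintype.prod_equiv e _ _ fun j => by rw [hμ, dif_pos (e j).2]; simp

end LaurentMonomials

section Coarsening

variable {K : Type} [Field K]

/-- **The coarsening**: for non-zero `xᵢ` and excluded indices `S`, the elements of `K` whose
value is bounded by a Laurent monomial in the `xᵢ`, `i ∉ S`, form a valuation subring. [folklore] -/
theorem topCoars_exists_W (O : ValuationSubring K) {n : ℕ} (x : Fin n → K) (hx0 : ∀ i, x i ≠ 0)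
    (S : Fin n → Prop) :
    ∃ W : ValuationSubring K, ∀ z : K, z ∈ W ↔
      ∃ m : Fin n → ℤ, (∀ j, S j → m j = 0) ∧ O.valuation z ≤ ∏ j, O.valuation (x j) ^ (m j) := by
  have hτ : ∀ j, O.valuation (x j) ≠ 0 := fun j => (map_ne_zero _).mpr (hx0 j)
  refine ⟨{ carrier := {z | ∃ m : Fin n → ℤ, (∀ j, S j → m j = 0) ∧
              O.valuation z ≤ ∏ j, O.valuation (x j) ^ (m j)}
            mul_mem' := ?_, one_mem' := ⟨0, fun _ _ => rfl, by simp⟩, add_mem' := ?_,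
            zero_mem' := ⟨0, fun _ _ => rfl, by simp⟩, neg_mem' := ?_,
            mem_or_inv_mem' := ?_ }, fun z => Iff.rfl⟩
  · rintro a b ⟨m, hm0, hm⟩ ⟨m', hm0', hm'⟩
    refine ⟨m + m', fun j hj => by simp [hm0 j hj, hm0' j hj], ?_⟩
    rw [map_mul, topCoars_zprod_add _ hτ]
    exact mul_le_mul' hm hm'
  · rintro a b ⟨m, hm0, hm⟩ ⟨m', hm0', hm'⟩
    rcases le_total (∏ j, O.valuation (x j) ^ (m j)) (∏ j, O.valuation (x j) ^ (m' j)) with h | h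
    · exact ⟨m', hm0', (Valuation.map_add _ _ _).trans (max_le (hm.trans h) hm')⟩
    · exact ⟨m, hm0, (Valuation.map_add _ _ _).trans (max_le hm (hm'.trans h))⟩
  · rintro a ⟨m, hm0, hm⟩
    exact ⟨m, hm0, by rwa [Valuation.map_neg]⟩
  · intro z
    by_cases hz : ∃ m : Fin n → ℤ, (∀ j, S j → m j = 0) ∧
        O.valuation z ≤ ∏ j, O.valuation (x j) ^ (m j)
    · exact Or.inl hz
    · right
      have h1 : ¬O.valuation z ≤ 1 := fun h => hz ⟨0, fun _ _ => rfl, by simpa using h⟩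
      refine ⟨0, fun _ _ => rfl, ?_⟩
      simp only [Pi.zero_apply, zpow_zero, Finset.prod_const_one, map_inv₀]
      exact inv_le_one_of_one_le₀ (not_le.mp h1).le

variable (O : ValuationSubring K) {n : ℕ} (x : Fin n → K) (S : Fin n → Prop) (W : ValuationSubring K)

/-- `O ≤ W` for the coarsening `W`. [folklore] -/
theorem topCoars_O_le
    (hW : ∀ z : K, z ∈ W ↔
      ∃ m : Fin n → ℤ, (∀ j, S j → m j = 0) ∧ O.valuation z ≤ ∏ j, O.valuation (x j) ^ (m j)) :
    O ≤ W := fun z hz =>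
  (hW z).mpr ⟨0, fun _ _ => rfl, by simpa using (O.valuation_le_one_iff z).mpr hz⟩

/-- **Non-units of the coarsening**: `W.valuation z < 1` iff `v(z)` is smaller than the value of
every Laurent monomial in the non-excluded parameters. [folklore] -/
theorem topCoars_small_iff (hx0 : ∀ i, x i ≠ 0)
    (hW : ∀ z : K, z ∈ W ↔
      ∃ m : Fin n → ℤ, (∀ j, S j → m j = 0) ∧ O.valuation z ≤ ∏ j, O.valuation (x j) ^ (m j))
    (z : K) :
    W.valuation z < 1 ↔
      ∀ m : Fin n → ℤ, (∀ j, S j → m j = 0) → O.valuation z < ∏ j, O.valuation (x j) ^ (m j) := by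
  have hτ : ∀ j, O.valuation (x j) ≠ 0 := fun j => (map_ne_zero _).mpr (hx0 j)
  constructor
  · intro h m hm
    by_contra hle
    rw [not_lt] at hle
    have hz0 : z ≠ 0 := by
      rintro rfl
      exact absurd ((map_zero O.valuation) ▸ hle) (not_le.mpr (topCoars_zprod_pos _ hτ m))
    have hinv : z⁻¹ ∈ W := by
      refine (hW _).mpr ⟨-m, fun j hj => by simp [hm j hj], ?_⟩
      rw [map_inv₀, topCoars_zprod_neg]
      exact (inv_le_inv₀ ((Valuation.pos_iff _).mpr hz0) (topCoars_zprod_pos _ hτ m)).mpr hle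
    have h1 : W.valuation z⁻¹ ≤ 1 := (W.valuation_le_one_iff _).mpr hinv
    rw [map_inv₀, inv_le_one₀ ((Valuation.pos_iff _).mpr hz0)] at h1
    exact absurd h (not_lt.mpr h1)
  · intro h
    have hzW : z ∈ W := (hW z).mpr ⟨0, fun _ _ => rfl, (h 0 fun _ _ => rfl).le⟩
    refine lt_of_le_of_ne ((W.valuation_le_one_iff z).mpr hzW) fun h1 => ?_
    have hz0 : z ≠ 0 := by
      rintro rfl
      exact zero_ne_one ((map_zero W.valuation) ▸ h1)
    have hinv : z⁻¹ ∈ W := (W.valuation_le_one_iff _).mp (by rw [map_inv₀, h1, inv_one])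
    obtain ⟨m, hm, hle⟩ := (hW _).mp hinv
    have hlt := h (-m) fun j hj => by simp [hm j hj]
    rw [topCoars_zprod_neg] at hlt
    rw [map_inv₀, inv_le_comm₀ ((Valuation.pos_iff _).mpr hz0) (topCoars_zprod_pos _ hτ m)] at hle
    exact absurd hlt (not_lt.mpr hle)

/-- The non-excluded parameters are units of the coarsening. [folklore] -/
theorem topCoars_val_param_eq_one (hx0 : ∀ i, x i ≠ 0)
    (hW : ∀ z : K, z ∈ W ↔
      ∃ m : Fin n → ℤ, (∀ j, S j → m j = 0) ∧ O.valuation z ≤ ∏ j, O.valuation (x j) ^ (m j))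
    {i : Fin n} (hi : ¬S i) : W.valuation (x i) = 1 := by
  classical
  have hsingle : ∀ c : ℤ, (∏ j, O.valuation (x j) ^ ((Pi.single i c : Fin n → ℤ) j)) =
      O.valuation (x i) ^ c := fun c => by
    rw [Finset.prod_eq_single i (fun j _ hj => by simp [hj]) (by simp)]
    simp
  have hlow : ∀ c : ℤ, ∀ j, S j → (Pi.single i c : Fin n → ℤ) j = 0 := fun c j hj => by
    have hji : j ≠ i := fun h => hi (h ▸ hj)
    simp [hji]
  have h1 : W.valuation (x i) ≤ 1 :=
    (W.valuation_le_one_iff _).mpr ((hW _).mpr ⟨Pi.single i 1, hlow 1, by rw [hsingle, zpow_one]⟩)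
  have h2 : W.valuation (x i)⁻¹ ≤ 1 :=
    (W.valuation_le_one_iff _).mpr ((hW _).mpr ⟨Pi.single i (-1), hlow (-1),
      by rw [hsingle, map_inv₀, zpow_neg, zpow_one]⟩)
  rw [map_inv₀, inv_le_one₀ ((Valuation.pos_iff _).mpr (hx0 i))] at h2
  exact le_antisymm h1 h2

end Coarsening

section Levels

variable {Γ₀ : Type} [LinearOrderedCommGroupWithZero Γ₀] {n : ℕ}

/-- Splitting an exponent vector into its level-`top` part and its low part. [folklore] -/
theorem topCoars_split (lv : Fin n → ℕ) (top : ℕ) (htop : ∀ i, lv i ≤ top) (c : Fin n → ℤ) :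
    ∃ cT cL : Fin n → ℤ, c = cT + cL ∧ (∀ j, lv j ≠ top → cT j = 0) ∧
      (∀ j, top ≤ lv j → cL j = 0) := by
  classical
  refine ⟨fun j => if top ≤ lv j then c j else 0, fun j => if top ≤ lv j then 0 else c j, ?_,
    fun j hj => if_neg fun h => hj (le_antisymm (htop j) h), fun j hj => if_pos hj⟩
  ext j
  by_cases h : top ≤ lv j <;> simp [h]

/-- **Uniform archimedean property of the top level** (from `LevelArchimedean` at `top`): for `τ^c`
smaller than all low monomials and any `τ^d` there is ONE exponent `M` with `(τ^c)^M < τ^d · τ^m`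
for all low `m` (one spare factor `τ^{c_T}` absorbs the low monomial). [folklore] -/
theorem topCoars_uniform_arch (τ : Fin n → Γ₀) (hτ : ∀ j, τ j ≠ 0) (lv : Fin n → ℕ) (top : ℕ)
    (htop : ∀ i, lv i ≤ top)
    (hC2b : ∀ μ μ' : Fin n → ℤ, (∀ j, lv j ≠ top → μ j = 0) → (∀ j, lv j ≠ top → μ' j = 0) →
      (∀ m : Fin n → ℤ, (∀ j, top ≤ lv j → m j = 0) → (∏ j, τ j ^ (μ j)) < ∏ j, τ j ^ (m j)) →
      ∃ N : ℕ, (∏ j, τ j ^ (μ j)) ^ N < ∏ j, τ j ^ (μ' j))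
    (c : Fin n → ℤ)
    (hc : ∀ m : Fin n → ℤ, (∀ j, top ≤ lv j → m j = 0) → (∏ j, τ j ^ (c j)) < ∏ j, τ j ^ (m j))
    (d : Fin n → ℤ) :
    ∃ M : ℕ, ∀ m : Fin n → ℤ, (∀ j, top ≤ lv j → m j = 0) →
      (∏ j, τ j ^ (c j)) ^ M < (∏ j, τ j ^ (d j)) * ∏ j, τ j ^ (m j) := by
  obtain ⟨cT, cL, rfl, hcT, hcL⟩ := topCoars_split lv top htop c
  obtain ⟨dT, dL, rfl, hdT, hdL⟩ := topCoars_split lv top htop d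
  have hcT_small : ∀ m : Fin n → ℤ, (∀ j, top ≤ lv j → m j = 0) →
      (∏ j, τ j ^ (cT j)) < ∏ j, τ j ^ (m j) := by
    intro m hm
    have h := hc (m + cL) fun j hj => by simp [hm j hj, hcL j hj]
    rw [topCoars_zprod_add τ hτ, topCoars_zprod_add τ hτ] at h
    exact lt_of_mul_lt_mul_right' h
  obtain ⟨M₀, hM₀⟩ := hC2b cT dT hcT hdT hcT_small
  refine ⟨M₀ + 1, fun m hm => ?_⟩
  obtain ⟨m', hm'⟩ : ∃ m' : Fin n → ℤ, m' = m + dL - (M₀ + 1) • cL := ⟨_, rfl⟩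
  have hm'low : ∀ j, top ≤ lv j → m' j = 0 := fun j hj => by
    simp [hm', hm j hj, hdL j hj, hcL j hj]
  have key : (∏ j, τ j ^ (cT j)) ^ M₀ * (∏ j, τ j ^ (cT j)) <
      (∏ j, τ j ^ (dT j)) * ∏ j, τ j ^ (m' j) :=
    mul_lt_mul_of_pos' hM₀ (hcT_small m' hm'low) (topCoars_zprod_pos τ hτ cT)
      (topCoars_zprod_pos τ hτ dT)
  have key2 := mul_lt_mul_of_pos_right key (topCoars_zprod_pos τ hτ ((M₀ + 1) • cL))
  have e1 : (∏ j, τ j ^ ((cT + cL) j)) ^ (M₀ + 1) =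
      (∏ j, τ j ^ (cT j)) ^ M₀ * (∏ j, τ j ^ (cT j)) * ∏ j, τ j ^ (((M₀ + 1) • cL) j) := by
    rw [topCoars_zprod_add τ hτ, mul_pow, pow_succ, topCoars_zprod_nsmul]
  have e2 : (∏ j, τ j ^ ((dT + dL) j)) * (∏ j, τ j ^ (m j)) =
      (∏ j, τ j ^ (dT j)) * (∏ j, τ j ^ (m' j)) * ∏ j, τ j ^ (((M₀ + 1) • cL) j) := by
    have hv : dL + m = m' + (M₀ + 1) • cL := by rw [hm']; abel
    rw [topCoars_zprod_add τ hτ, mul_assoc, ← topCoars_zprod_add τ hτ dL m, mul_assoc,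
      ← topCoars_zprod_add τ hτ m', hv]
  rw [e1, e2]
  exact key2

variable {K : Type} [Field K]

/-- **Rank one of the coarsening**: if values are torsion over the parameter lattice and the top
level is uniformly archimedean modulo the low monomials, then for `z ∈ 𝔪_W` and `w ≠ 0` some
power of `z` is `W`-smaller than `w`. [folklore] -/
theorem topCoars_rankOne (O : ValuationSubring K) (x : Fin n → K) (S : Fin n → Prop)
    (W : ValuationSubring K) (hx0 : ∀ i, x i ≠ 0)
    (hW : ∀ z : K, z ∈ W ↔
      ∃ m : Fin n → ℤ, (∀ j, S j → m j = 0) ∧ O.valuation z ≤ ∏ j, O.valuation (x j) ^ (m j))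
    (htors : ∀ z : K, z ≠ 0 → ∃ N : ℕ, N ≠ 0 ∧ ∃ m : Fin n → ℤ,
      O.valuation z ^ N = ∏ i, O.valuation (x i) ^ (m i))
    (hL : ∀ c : Fin n → ℤ,
      (∀ m : Fin n → ℤ, (∀ j, S j → m j = 0) →
        (∏ j, O.valuation (x j) ^ (c j)) < ∏ j, O.valuation (x j) ^ (m j)) →
      ∀ d : Fin n → ℤ, ∃ M : ℕ, ∀ m : Fin n → ℤ, (∀ j, S j → m j = 0) →
        (∏ j, O.valuation (x j) ^ (c j)) ^ M <
          (∏ j, O.valuation (x j) ^ (d j)) * ∏ j, O.valuation (x j) ^ (m j)) :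
    ∀ z w : K, W.valuation z < 1 → w ≠ 0 → ∃ N : ℕ, W.valuation z ^ N < W.valuation w := by
  intro z w hz hw
  have hw' : 0 < W.valuation w := (Valuation.pos_iff _).mpr hw
  by_cases hz0 : z = 0
  · exact ⟨1, by rwa [hz0, map_zero, pow_one]⟩
  have hzs := (topCoars_small_iff O x S W hx0 hW z).mp hz
  obtain ⟨N₁, hN₁, a, ha⟩ := htors z hz0
  obtain ⟨N₂, hN₂, b, hb⟩ := htors w hw
  have hvz1 : O.valuation z < 1 := by simpa using hzs 0 fun _ _ => rfl
  have haS : ∀ m : Fin n → ℤ, (∀ j, S j → m j = 0) →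
      (∏ j, O.valuation (x j) ^ (a j)) < ∏ j, O.valuation (x j) ^ (m j) := by
    intro m hm
    rw [← ha]
    have h1 : O.valuation z ^ N₁ ≤ O.valuation z := by
      simpa using pow_le_pow_right_of_le_one' hvz1.le (Nat.one_le_iff_ne_zero.mpr hN₁)
    exact h1.trans_lt (hzs m hm)
  obtain ⟨M, hM⟩ := hL a haS b
  refine ⟨N₁ * M, ?_⟩
  rw [← map_pow, ← div_lt_one₀ hw', ← map_div₀, topCoars_small_iff O x S W hx0 hW]
  intro m hm
  rw [map_div₀, map_pow, div_lt_iff₀ ((Valuation.pos_iff _).mpr hw)]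
  refine lt_of_pow_lt_pow_left₀ N₂ zero_le ?_
  rw [mul_pow, hb, pow_mul, ha, ← topCoars_zprod_nsmul _ N₂ m]
  have hxa1 : (∏ j, O.valuation (x j) ^ (a j)) ^ M ≤ 1 :=
    pow_le_one' (by simpa using (haS 0 fun _ _ => rfl).le) M
  calc ((∏ j, O.valuation (x j) ^ (a j)) ^ M) ^ N₂
        ≤ (∏ j, O.valuation (x j) ^ (a j)) ^ M := by
          simpa using pow_le_pow_right_of_le_one' hxa1 (Nat.one_le_iff_ne_zero.mpr hN₂)
    _ < (∏ j, O.valuation (x j) ^ (b j)) * ∏ j, O.valuation (x j) ^ ((N₂ • m) j) :=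
          hM (N₂ • m) fun j hj => by simp [hm j hj]
    _ = (∏ j, O.valuation (x j) ^ ((N₂ • m) j)) * ∏ j, O.valuation (x j) ^ (b j) := mul_comm _ _

/-- **Centre of the coarsening on `R`**: by (C3) at `ℓ = top`, the level-`top` parameters
(enumerated by `e`) generate `𝔪_W ∩ R`. [folklore] -/
theorem topCoars_centre {k : Type} [Field k] [Algebra k K] (O : ValuationSubring K)
    (R : Subalgebra k K) (x : Fin n → K) (hx : ∀ i, x i ∈ R)
    (lv : Fin n → ℕ) (top : ℕ) (htop : ∀ i, lv i ≤ top)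
    (hC3 : ∀ z : R.toSubring,
      z ∈ Ideal.span (Set.range fun i : {i : Fin n // top ≤ lv i} => (⟨x i.1, hx i.1⟩ : R.toSubring)) ↔
        ∀ m : Fin n → ℤ, (∀ j, top ≤ lv j → m j = 0) →
          O.valuation (z : K) < ∏ j, O.valuation (x j) ^ (m j))
    (W : ValuationSubring K) (hRW : R.toSubring ≤ W.toSubring)
    (hWsmall : ∀ z : K, W.valuation z < 1 ↔
      ∀ m : Fin n → ℤ, (∀ j, top ≤ lv j → m j = 0) →
        O.valuation z < ∏ j, O.valuation (x j) ^ (m j))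
    {nT : ℕ} (e : Fin nT ≃ {i : Fin n // lv i = top}) :
    Ideal.span (Set.range fun j => (⟨x (e j).1, hx (e j).1⟩ : R.toSubring)) =
      Ideal.comap (Subring.inclusion hRW) (maximalIdeal W) := by
  have hrange : (Set.range fun j => (⟨x (e j).1, hx (e j).1⟩ : R.toSubring)) =
      Set.range fun i : {i : Fin n // top ≤ lv i} => (⟨x i.1, hx i.1⟩ : R.toSubring) := by
    ext z
    refine ⟨fun ⟨j, hj⟩ => ⟨⟨(e j).1, (e j).2.ge⟩, hj⟩, fun ⟨i, hi⟩ => ?_⟩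
    exact ⟨e.symm ⟨i.1, le_antisymm (htop i.1) i.2⟩, by simpa only [Equiv.apply_symm_apply]⟩
  rw [hrange]
  ext z
  rw [hC3 z, Ideal.mem_comap, ValuationSubring.valuation_lt_one_iff, Subring.coe_inclusion,
    hWsmall]

/-- **Independence of the `W`-values of the level-`top` parameters** ((C4) at `ℓ = top`): a
`W`-unit Laurent monomial in them is squeezed between two low monomials. [folklore] -/
theorem topCoars_valIndep (O : ValuationSubring K) (x : Fin n → K) (hx0 : ∀ i, x i ≠ 0)
    (lv : Fin n → ℕ) (top : ℕ)
    (hC4 : ∀ μ : Fin n → ℤ, (∀ j, lv j ≠ top → μ j = 0) → μ ≠ 0 →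
      (∀ m : Fin n → ℤ, (∀ j, top ≤ lv j → m j = 0) →
        (∏ j, O.valuation (x j) ^ (μ j)) < ∏ j, O.valuation (x j) ^ (m j)) ∨
      (∀ m : Fin n → ℤ, (∀ j, top ≤ lv j → m j = 0) →
        (∏ j, O.valuation (x j) ^ (m j)) < ∏ j, O.valuation (x j) ^ (μ j)))
    (W : ValuationSubring K)
    (hW : ∀ z : K, z ∈ W ↔ ∃ m : Fin n → ℤ, (∀ j, top ≤ lv j → m j = 0) ∧
      O.valuation z ≤ ∏ j, O.valuation (x j) ^ (m j))
    {nT : ℕ} (e : Fin nT ≃ {i : Fin n // lv i = top}) :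
    ∀ m : Fin nT → ℤ, (∏ j, W.valuation (x (e j).1) ^ (m j)) = 1 → m = 0 := by
  have hτ : ∀ j, O.valuation (x j) ≠ 0 := fun j => (map_ne_zero _).mpr (hx0 j)
  intro m hm
  obtain ⟨μ, hμ⟩ : ∃ μ : Fin n → ℤ, ∀ i, μ i = if h : lv i = top then m (e.symm ⟨i, h⟩) else 0 :=
    ⟨_, fun _ => rfl⟩
  have hμtop : ∀ j, lv j ≠ top → μ j = 0 := fun j hj => by rw [hμ, dif_neg hj]
  have hmμ : ∀ j, m j = μ (e j).1 := fun j => by rw [hμ, dif_pos (e j).2]; simp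
  have hWP : W.valuation (∏ i, x i ^ (μ i)) = 1 := by
    rw [map_prod, ← hm, topCoars_prod_reindex lv top e (fun i => W.valuation (x i)) m μ hμ]
    exact Finset.prod_congr rfl fun i _ => map_zpow₀ _ _ _
  have hOP : O.valuation (∏ i, x i ^ (μ i)) = ∏ i, O.valuation (x i) ^ (μ i) := by
    rw [map_prod]
    exact Finset.prod_congr rfl fun i _ => map_zpow₀ _ _ _
  have h1 : (∏ i, x i ^ (μ i)) ∈ W := (W.valuation_le_one_iff _).mp hWP.le
  have h2 : (∏ i, x i ^ (μ i))⁻¹ ∈ W :=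
    (W.valuation_le_one_iff _).mp (by rw [map_inv₀, hWP, inv_one])
  obtain ⟨m', hm'low, hm'⟩ := (hW _).mp h1
  obtain ⟨m'', hm''low, hm''⟩ := (hW _).mp h2
  rw [hOP] at hm'
  rw [map_inv₀, hOP, inv_le_comm₀ (topCoars_zprod_pos _ hτ μ) (topCoars_zprod_pos _ hτ m'')]
    at hm''
  by_contra hm0
  have hμ0 : μ ≠ 0 := fun h => hm0 (funext fun j => by rw [hmμ, h]; rfl)
  rcases hC4 μ hμtop hμ0 with h | h
  · have hlt := h (-m'') fun j hj => by simp [hm''low j hj]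
    rw [topCoars_zprod_neg] at hlt
    exact absurd hlt (not_lt.mpr hm'')
  · exact absurd (h m' hm'low) (not_lt.mpr hm')

end Levels

set_option linter.unusedVariables false in
/-- **Top coarsening of a flag-adapted chart.** For a flag-adapted chart `(R, x, lv)` along `O`
whose values are torsion over the lattice of parameter values, and `top` the highest level,
the coarsening `W := {z : v(z) ≤ v(x^m) for some m supported on the levels < top}` is a
valuation ring `⊇ O` with that membership characterization; it is of rank one in the elementary
sense; the parameters of level `< top` are `W`-units; and `(R, x_top)` is a very good `W`-chart:
the level-`top` parameters generate `𝔪_W ∩ R` ((C3) at `ℓ = top`) and their `W`-values are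
`ℤ`-independent ((C4) at `ℓ = top`). Rank one uses the clause `LevelArchimedean` at `ℓ = top`
and the torsion hypothesis (the parameter-wise (C2b) of `AdaptedValues` would not suffice:
values `(1,0), (1,1)` in `ℤ² lex`). [folklore] -/
theorem stub_topCoarsening :
    ∀ (k K : Type) [Field k] [Field K] [Algebra k K] (O : ValuationSubring K) (n : ℕ) (R : Subalgebra k K)
    (hRO : R.toSubring ≤ O.toSubring) (x : Fin n → K) (hx : ∀ i, x i ∈ R) (lv : Fin n → ℕ),
    FlagAdaptedChart O R hRO x hx lv →
    (∀ z : K, z ≠ 0 → ∃ N : ℕ, N ≠ 0 ∧ ∃ m : Fin n → ℤ, O.valuation z ^ N = ∏ i, O.valuation (x i) ^ (m i)) →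
    ∀ (top : ℕ), (∀ i, lv i ≤ top) → (∃ i, lv i = top) → (∃ i, lv i < top) →
    ∃ (W : ValuationSubring K) (hOW : O ≤ W),
      (∀ z : K, z ∈ W ↔ ∃ m : Fin n → ℤ, (∀ j, top ≤ lv j → m j = 0) ∧
        O.valuation z ≤ ∏ j, O.valuation (x j) ^ (m j)) ∧
      (∀ z w : K, W.valuation z < 1 → w ≠ 0 → ∃ N : ℕ, W.valuation z ^ N < W.valuation w) ∧
      (∀ i, lv i < top → W.valuation (x i) = 1) ∧
      ∃ (nT : ℕ) (e : Fin nT ≃ {i : Fin n // lv i = top}),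
        Ideal.span (Set.range fun j => (⟨x (e j).1, hx (e j).1⟩ : R.toSubring)) =
          Ideal.comap (Subring.inclusion (hRO.trans (fun z hz => hOW hz))) (maximalIdeal W) ∧
        (∀ m : Fin nT → ℤ, (∏ j, W.valuation (x (e j).1) ^ (m j)) = 1 → m = 0) := by
  intro k K _ _ _ O n R hRO x hx lv hA htors top htop _ _
  obtain ⟨⟨-, hx0, -, -, ⟨-, -, hC4⟩, hC3⟩, hLA⟩ := hA
  have hτ : ∀ j, O.valuation (x j) ≠ 0 := fun j => (map_ne_zero _).mpr (hx0 j)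
  obtain ⟨W, hW⟩ := topCoars_exists_W O x hx0 (fun j => top ≤ lv j)
  have hOW : O ≤ W := topCoars_O_le O x _ W hW
  exact ⟨W, hOW, hW, topCoars_rankOne O x _ W hx0 hW htors
      (topCoars_uniform_arch (fun i => O.valuation (x i)) hτ lv top htop (hLA top)),
    fun i hi => topCoars_val_param_eq_one O x _ W hx0 hW (not_le.mpr hi),
    Fintype.card {i : Fin n // lv i = top}, (Fintype.equivFin _).symm,
    topCoars_centre O R x hx lv top htop (hC3 top) W _ (topCoars_small_iff O x _ W hx0 hW) _,
    topCoars_valIndep O x hx0 lv top (hC4 top) W hW _⟩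

end Summit.ResolutionOfSingularities.ResolutionOfSingularities.Theorems.PfaffLine
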